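import Summits.BirchSwinnertonDyer.BirchSwinnertonDyer.Theorems.ManinLocalTwoThreeManinConstantFortyFive
import Summits.BirchSwinnertonDyer.Rank1Residual.Additive.IntModelConductorCertificate
import HarnessLib

/-!
# Level 45: `N(45a1) = 45` by a kernel Tate certificate (`I₁*` at `3`, non-split multiplicative at `5`), and the `X₀(45)`-domain of C3 is
# inhabited under modularity

Cell bsd-f2-manin, route `ManinLocalTwoThree` (crux C3 `ManinPrimeToThreeAtNine`, stmt-22968: `3² ∣ 45`), prover seat p2 gen 29; non-vacuity companion
of `ManinConstantFortyFive` (`|c| = 1 ∧ 3 ∤ c` on `X₀(45)`, unconditional).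

* §1 **`N([1,−1,0,0,−5]) = 45 = 3²·5`**: deep Tate certificate at `3` — change `(r, s, t) = (−4, 1, 2)` to `[3, −15, 0, 54, −81]`, exit `I₁*`
  (`3 ∥ a₂`, `9 ∣ a₃`, `27 ∣ a₄`, `81 ∣ a₆`, `(a₃/9)² + 4a₆/81 = −4` prime to `3`; `f₃ = v₃(Δ) + 1 − 6 = 2`), good at `2`, non-split multiplicative at `5`
  (`v₅(Δ) = 1`, Euler witness); kernel-checked, NO named fact;
* §2 under the item's binder `exists_isNewformOf` (modularity): `45a1` has a newform in `S₂(Γ₀(45))`, and a lattice-optimal `X₀(45)`-datum on a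
  globally minimal model of the class `45a` exists — C3's `∀`-domain at `N = 45` is inhabited relative to the item's hypotheses — with `|c| = 1`.

Nothing here proves C3, Manin's conjecture or BSD. [cite: Silverman1994, IV.9.4] [cite: CremonaAlgorithms1997, Table 1 (45a1)] [cite: EdixhovenManin1991, Prop. 2]
-/

set_option autoImplicit false
-- lint-debt: the directory name repeats the summit name (sibling precedent `ManinLocalTwoThreeNonVacuityFiftySix.lean`)
set_option linter.dupNamespace false

noncomputable section

open Complex
open scoped MatrixGroups ModularForm
open ModularForm CongruenceSubgroup WeierstrassCurve
open Summit.BirchSwinnertonDyer.Rank1Residual.Additive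
open Literature.NumberTheory.Automorphic
open Literature.NumberTheory.EllipticCurves Literature.NumberTheory.EllipticCurves.ModularForms

namespace Summit.BirchSwinnertonDyer.BirchSwinnertonDyer.Theorems.ManinLocalTwoThree.NonVacuityFortyFive

open ManinConstantFortyFive
open TwoAdicTwistConverse (isElliptic_45a1)

/-! ## §1 The conductor `N(45a1) = 45` -/

/-- The literal `ℚ`-model `[1, −1, 0, 0, −5]` read through integer casts. [folklore] -/
theorem mk_fortyFiveA1_eq_cast :
    (⟨1, -1, 0, 0, -5⟩ : WeierstrassCurve ℚ) = ⟨((1 : ℤ) : ℚ), ((-1 : ℤ) : ℚ), ((0 : ℤ) : ℚ), ((0 : ℤ) : ℚ), ((-5 : ℤ) : ℚ)⟩ := by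
  ext <;> norm_num

/-- **`N([1, −1, 0, 0, −5]) = 45 = 3²·5`**: deep Tate certificate at `3` (`(r,s,t) = (−4,1,2)`, exit `I₁*`, `f₃ = 2`), good at `2`, non-split multiplicative
at `5`; kernel-checked. [cite: Silverman1994, IV.9.4] [cite: CremonaAlgorithms1997, Table 1 (45a1)] -/
theorem conductorNorm_fortyFiveA1 : (⟨1, -1, 0, 0, -5⟩ : WeierstrassCurve ℚ).conductorNorm ℤ = 45 := by
  rw [mk_fortyFiveA1_eq_cast]
  exact IntModelCond.conductorNorm_mk_eq_of_certs_of_eq 1 (-1) 0 0 (-5)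
    (cm := ⟨0, 0, 0, [⟨3, 1, 7, 0, 0⟩, ⟨5, 2, 1, 0, 0⟩]⟩) (c := ⟨0, 0, 0, 7, 2, 3, [⟨5, 2, 1, 0, 0⟩]⟩)
    (l₂ := ⟨0, 0, 0, 0, 0, 0, 0⟩) (l₃ := ⟨3, -4, 1, 2, 7, 71, 0⟩)
    (by decide +kernel) (by decide +kernel) (by decide +kernel) (by decide +kernel) (by decide +kernel)

/-! ## §2 Under modularity: a newform of `45a1` in `S₂(Γ₀(45))` and an inhabited domain -/

/-- **Modularity at `45a1`, levelled**: under `exists_isNewformOf` the curve `[1, −1, 0, 0, −5]` has a newform in `S₂(Γ₀(45))` (its conductor IS `45`).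
CONDITIONAL on the item's own binder `exists_isNewformOf`. [cite: DiamondShurman2005, Thm. 8.8.3] -/
theorem exists_isNewformOf_fortyFiveA1 (hnf : exists_isNewformOf) :
    ∃ f : CuspForm (Gamma0 45) 2, IsNewformOf (⟨1, -1, 0, 0, -5⟩ : WeierstrassCurve ℚ) f := by
  haveI := isElliptic_45a1
  have key : ∀ (N : ℕ) [NeZero N], (⟨1, -1, 0, 0, -5⟩ : WeierstrassCurve ℚ).conductorNorm ℤ = N →
      ∃ f : CuspForm (Gamma0 N) 2, IsNewformOf (⟨1, -1, 0, 0, -5⟩ : WeierstrassCurve ℚ) f := by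
    intro N _ hN
    subst hN
    exact hnf _
  haveI : NeZero (45 : ℕ) := ⟨by decide⟩
  exact key 45 conductorNorm_fortyFiveA1

/-- **A lattice-optimal `X₀(45)`-datum on a globally minimal model in the class `45a` exists under modularity**, i.e. C3's `∀`-domain at `N = 45`
is inhabited relative to the item's hypotheses, and the datum has `|c| = 1` (so `3 ∤ c`); CONDITIONAL on `exists_isNewformOf` only.
[cite: EdixhovenManin1991, Prop. 2] -/
theorem maninPrimeToThreeAtNine_domain_inhabited_fortyFive_of_modularity (hnf : exists_isNewformOf) :
    ∃ (W₀ : WeierstrassCurve ℚ) (_ : W₀.IsElliptic) (_ : W₀.IsGloballyMinimal) (D₀ : ModularParametrizationData W₀ 45),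
      (⟨1, -1, 0, 0, -5⟩ : WeierstrassCurve ℚ).IsIsogenous W₀ ∧ (∀ z ∈ D₀.L.lattice, ∃ w ∈ periodLattice D₀.f, z = D₀.c * w) ∧
      |D₀.maninConstant| = 1 ∧ ¬ (3 : ℤ) ∣ D₀.maninConstant ∧ 3 ^ 2 ∣ 45 := by
  haveI := isElliptic_45a1
  haveI : NeZero (45 : ℕ) := ⟨by decide⟩
  obtain ⟨f, hf⟩ := exists_isNewformOf_fortyFiveA1 hnf
  obtain ⟨D⟩ := nonempty_modularParametrizationData_of_isNewformOf hf
  obtain ⟨W₀, h₀, hmin, D₀, -, hiso, hopt, -⟩ :=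
    ExistsMinimalOptimalDatum.existsMinimalOptimalDatum_full (⟨1, -1, 0, 0, -5⟩ : WeierstrassCurve ℚ) D
  exact ⟨W₀, h₀, hmin, D₀, hiso, hopt, @abs_maninConstant_eq_one_fortyFive W₀ h₀ hmin D₀ hopt,
    @not_three_dvd_maninConstant_fortyFive W₀ h₀ hmin D₀ hopt, EtaIdentitiesFortyFive.three_sq_dvd_fortyFive⟩

/-- **C3's body at `N = 45` in the item's literal shape, with the domain inhabited**: `3² ∣ 45 → 3 ∤ c(D)` for every datum with the lattice clause
(UNCONDITIONAL), and a datum exists GIVEN `exists_isNewformOf`. [cite: AgasheRibetStein2006, §§1–2] -/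
theorem maninPrimeToThreeAtNine_fortyFive_inhabited (hnf : exists_isNewformOf) :
    (∃ (W₀ : WeierstrassCurve ℚ) (_ : W₀.IsElliptic) (_ : W₀.IsGloballyMinimal) (D₀ : ModularParametrizationData W₀ 45),
        (∀ z ∈ D₀.L.lattice, ∃ w ∈ periodLattice D₀.f, z = D₀.c * w) ∧ |D₀.maninConstant| = 1) ∧
      ∀ (W : WeierstrassCurve ℚ) [W.IsElliptic] [W.IsGloballyMinimal] (D : ModularParametrizationData W 45),
        (∀ z ∈ D.L.lattice, ∃ w ∈ periodLattice D.f, z = D.c * w) → 3 ^ 2 ∣ 45 → ¬ (3 : ℤ) ∣ D.maninConstant := by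
  refine ⟨?_, fun W _ _ D hopt _ ↦ not_three_dvd_maninConstant_fortyFive W D hopt⟩
  obtain ⟨W₀, h₀, hmin, D₀, -, hopt, habs, -⟩ := maninPrimeToThreeAtNine_domain_inhabited_fortyFive_of_modularity hnf
  exact ⟨W₀, h₀, hmin, D₀, hopt, habs⟩

end Summit.BirchSwinnertonDyer.BirchSwinnertonDyer.Theorems.ManinLocalTwoThree.NonVacuityFortyFive

end
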